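import Summits.BirchSwinnertonDyer.BirchSwinnertonDyer.Theorems.PrintX11aGamma0ParabolicCongruence
import Summits.BirchSwinnertonDyer.BirchSwinnertonDyer.Theorems.ConjSpanGenAllLevelsDefs
import Literature.NumberTheory.Automorphic.CongruenceSubgroupPropertySL2AwayHolds
import Literature.GroupTheory.ArithmeticGroups.ElementaryBoundedGeneration
import HarnessLib

/-!
# Crux `X11aLowerHalf` (item stmt-BirchSwinnertonDyer-19064), stub `stub_muAnSurjDeepFive` side — «NONEXTENSION»:
# a parabolic-trivial character of `Γ₀(N)` with finite image that EXTENDS to the `p`-arithmetic group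
# `Γ₀(M; ℤ[1/p])` is Eisenstein — fact-free (Serre's CSP for `SL₂(ℤ[1/p])`, proved in the tree, + Lemma E)

Cell `bsd-print-x11a`, width seat bsd-line-x11a-p1-w2 g4 (`--supports stmt-BirchSwinnertonDyer-19064`).  BSD is not proved by
any of this; nothing is asserted about any curve; PARTITION 0.  Pure group theory.

THE STATEMENT (bsd-idea-17's `FwSolenoid.NonExtension`, `Cruxes/UpperNonSurjFive/FwSolenoidSketch.lean`, in the tree's
`SL₂(ℤ[1/p])` vocabulary of `Theorems/ConjSpanGenAllLevelsDefs.lean` — `Away p = ℤ[1/p]`, `iota p : SL₂(ℤ) → SL₂(ℤ[1/p])`,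
`Delta p M = Γ₀(M; ℤ[1/p]) = {g : g₂₁ ∈ M·ℤ[1/p]}`): for `m ≥ 2`, `M ≥ 1`, `M ∣ N`, a homomorphism `χ : Γ₀(N) → F` into a
FINITE group which kills the two standard parabolics `T = (1 1; 0 1)`, `V_N = (1 0; N 1)` and which is the restriction
along `ι` of a map `Φ : SL₂(ℤ[1/m]) → F` multiplicative on `Δ = Γ₀(M; ℤ[1/m])` kills `Γ₁(N)` («Eisenstein»):

* `map_eq_one_of_parabolic_of_extends` (function form, the shape of the tree's amalgam theorem
  `gamma0Away_character_extension_of_shiftInvariant`), `map_eq_one_of_parabolic_of_extends_hom` (`Φ : Δ →* F`),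
  `map_eq_one_of_traceTwo_of_extends` (trace-`±2` hypothesis = bsd-idea-17's `IsTypeII`).

Proof: `ker Φ|_Δ` has finite index in `SL₂(ℤ[1/m])` (`Δ ⊇ Γ((M))`, and `ℤ[1/m]/(M)` is finite — tree
`finite_quotient_away_span_natCast`, `Gamma_finiteIndex_of_finite_quotient`; `F` finite), so by Serre's congruence
subgroup property for `SL₂(ℤ[1/m])` — PROVED in the tree, `SerreSL2Congruence1970_congruenceSubgroupProperty_away_holds`
(Serre 1970 §2.6 / Mennicke 1967, via Vaserstein) — it contains every `g ≡ 1 (mod L)` for some `L ≥ 1`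
(`exists_level_forall_dvd_imp_mem`); hence `χ` kills `Γ₀(N) ∩ Γ(L)`, and Lemma E (`Theorems/PrintX11aGamma0ParabolicCongruence.lean`,
Kurth–Long 2008 Prop. 3.2) finishes.  CONTRAPOSITIVE = the ENGINE the crux idea `fw-solenoid` asks for, now a theorem: a
cuspidal (non-Eisenstein, parabolic-trivial) mod-`p` homology character of `X₀(pM)` does NOT extend to `Γ₀(M; ℤ[1/p])` —
the cusp-label cocycle of a cuspidal character over the Hecke tree at `p` is never a coboundary.  With the tree's
Bass–Serre amalgam `Γ₀(M; ℤ[1/p]) = Γ₀(M) *_{Γ₀(pM)} Γ₀(M)′` (`gamma0Away_character_extension_of_shiftInvariant_holds`) this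
is the group-theoretic form of Ihara's lemma mod `p` (shift-invariant version): see the closing remark of bsd-idea-17's card
(v2 «Reformulation»).  What it does NOT do: it says nothing about ORBIT SUMS (the ω⁰ branch); `stub_muAnSurjDeepFive` stays
open — this file and its sibling are the algebraic half of the only mechanism proposed for it on the hub, image-independent.
beyond-print: no (CSP 1967/1970 + Kurth–Long 2008; the packaging is folklore «Ihara»).  No summit statement is proved by this seat.

References: [SerreSL2Congruence1970] §1.2, §2.6 Thm. 2 (b), Cor. 3; [KurthLong2008] Prop. 3.2; [Vaserstein1972SL2] Theorem.
-/

set_option linter.dupNamespace false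
set_option autoImplicit false

namespace Summit.BirchSwinnertonDyer.BirchSwinnertonDyer.Theorems.Gamma0Parabolic

open scoped MatrixGroups
open CongruenceSubgroup Matrix.SpecialLinearGroup
open Literature.NumberTheory.Automorphic Literature.NumberTheory.Automorphic.SL2Rel
open Summit.BirchSwinnertonDyer.BirchSwinnertonDyer.Theorems.ConjSpanGenAllLevels (Away iota Delta)

/-! ### §1 `Δ = Γ₀(M; ℤ[1/m])` has finite index; `ι Γ₀(N) ≤ Δ` for `M ∣ N` -/

section Delta

variable {m M N : ℕ}

/-- `Γ((M)) ≤ Γ₀(M; ℤ[1/m])`: a matrix `≡ 1 (mod M)` has lower-left entry in `M·ℤ[1/m]`.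
[cite: SerreSL2Congruence1970, §1.2] -/
theorem gamma_span_le_delta : Gamma (Ideal.span {((M : ℕ) : Away m)}) ≤ Delta m M := by
  intro g hg
  obtain ⟨-, h10, -, -⟩ := mem_Gamma.1 hg
  obtain ⟨t, ht⟩ := Ideal.mem_span_singleton'.1 h10
  exact ⟨t, by rw [← ht, mul_comm]⟩

/-- **`Γ₀(M; ℤ[1/m])` has finite index in `SL₂(ℤ[1/m])`** (`M ≥ 1`): it contains `Γ((M))`, and `ℤ[1/m]/(M)` is finite.
[cite: SerreSL2Congruence1970, §1.2] -/
theorem delta_finiteIndex (hM : 0 < M) : (Delta m M).FiniteIndex := by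
  haveI := Literature.GroupTheory.ArithmeticGroups.finite_quotient_away_span_natCast (m := m) hM.ne'
  haveI : (Gamma (Ideal.span {((M : ℕ) : Away m)})).FiniteIndex :=
    Literature.GroupTheory.ArithmeticGroups.Gamma_finiteIndex_of_finite_quotient _
  exact Subgroup.finiteIndex_of_le (gamma_span_le_delta (m := m) (M := M))

/-- `ι Γ₀(N) ≤ Γ₀(M; ℤ[1/m])` for `M ∣ N`. [folklore] -/
theorem iota_mem_delta (hMN : M ∣ N) (γ : Gamma0 N) : iota m (γ : SL(2, ℤ)) ∈ Delta m M := by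
  obtain ⟨k, hk⟩ := hMN
  have h0 : ((((γ : SL(2, ℤ)) 1 0 : ℤ)) : ZMod N) = 0 := Gamma0_mem.1 γ.2
  obtain ⟨c, hc⟩ := (ZMod.intCast_zmod_eq_zero_iff_dvd _ N).1 h0
  refine ⟨((k : ℤ) * c : ℤ), ?_⟩
  rw [ConjSpanGenAllLevels.iota_apply, hc, hk]
  push_cast
  ring

end Delta

/-! ### §2 NonExtension -/

section NonExtension

variable {m M N : ℕ}

/-- **NONEXTENSION (function form).**  Let `m ≥ 2`, `M ≥ 1`, `N` any level, `F` a FINITE group, `χ : Γ₀(N) → F` a homomorphism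
killing `T = (1 1; 0 1)` and `V_N = (1 0; N 1)`, and suppose `χ` extends along `ι : SL₂(ℤ) → SL₂(ℤ[1/m])` to a map
`Φ : SL₂(ℤ[1/m]) → F` multiplicative on `Δ = Γ₀(M; ℤ[1/m])`.  Then `χ` kills `Γ₁(N)` (is Eisenstein).  Ingredients: Serre's
congruence subgroup property for `SL₂(ℤ[1/m])` (tree theorem `…congruenceSubgroupProperty_away_holds`) and Lemma E
(`map_eq_one_of_parabolic_of_congruence`). [cite: SerreSL2Congruence1970, §2.6 Thm. 2 (b), Cor. 3] [cite: KurthLong2008, Prop. 3.2] -/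
theorem map_eq_one_of_parabolic_of_extends (hm : 2 ≤ m) (hM : 0 < M)
    {F : Type*} [Group F] [Finite F] (χ : Gamma0 N →* F)
    (hpar : ∀ γ : Gamma0 N, (γ : SL(2, ℤ)) = e12 1 ∨ (γ : SL(2, ℤ)) = e21 (N : ℤ) → χ γ = 1)
    (Φ : SL(2, Away m) → F)
    (hΦmul : ∀ g ∈ Delta m M, ∀ g' ∈ Delta m M, Φ (g * g') = Φ g * Φ g')
    (hΦχ : ∀ γ : Gamma0 N, Φ (iota m (γ : SL(2, ℤ))) = χ γ) :
    ∀ γ ∈ Gamma1' N, χ γ = 1 := by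
  -- `Φ` restricted to `Δ` as a homomorphism
  have hΦone : Φ 1 = 1 := by
    have h := hΦmul 1 (Subgroup.one_mem _) 1 (Subgroup.one_mem _)
    rw [one_mul] at h
    have h2 : Φ 1 * Φ 1 = Φ 1 * 1 := by rw [mul_one]; exact h.symm
    exact mul_left_cancel h2
  let ΦD : Delta m M →* F :=
    { toFun := fun d => Φ d.1
      map_one' := hΦone
      map_mul' := fun d d' => hΦmul d.1 d.2 d'.1 d'.2 }
  -- its kernel, pushed into `SL₂(ℤ[1/m])`, has finite index
  set K : Subgroup SL(2, Away m) := ΦD.ker.map (Delta m M).subtype with hK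
  haveI hΔ : (Delta m M).FiniteIndex := delta_finiteIndex (m := m) hM
  haveI : Finite ΦD.range := inferInstance
  have hKfi : K.FiniteIndex := by
    refine ⟨?_⟩
    rw [hK, Subgroup.index_map_subtype, Subgroup.index_ker]
    exact mul_ne_zero Nat.card_pos.ne' hΔ.index_ne_zero
  -- Serre's congruence subgroup property: `K ⊇ {g ≡ 1 (mod L)}` for some `L ≥ 1`
  obtain ⟨L, hL, hKL⟩ := exists_level_forall_dvd_imp_mem
    SerreSL2Congruence1970_congruenceSubgroupProperty_away_holds hm K hKfi
  -- hence `χ` kills `Γ₀(N) ∩ Γ(L)`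
  have hcong : ∀ γ : Gamma0 N, (γ : SL(2, ℤ)) ∈ Gamma L → χ γ = 1 := by
    intro γ hγ
    have hγ' := Gamma_mem.1 hγ
    have hdvd : ∀ i j, ((L : ℕ) : Away m) ∣
        (iota m (γ : SL(2, ℤ))) i j - (1 : SL(2, Away m)) i j := by
      have key : ∀ z w : ℤ, ((z : ZMod L) = (w : ZMod L)) →
          ((L : ℕ) : Away m) ∣ ((z : Away m) - (w : Away m)) := by
        intro z w hzw
        obtain ⟨c, hc⟩ := (ZMod.intCast_eq_intCast_iff_dvd_sub w z L).1 hzw.symm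
        exact ⟨(c : Away m), by rw [← Int.cast_sub, hc]; push_cast; ring⟩
      intro i j
      fin_cases i <;> fin_cases j
      · simpa using key _ 1 (by simpa using hγ'.1)
      · simpa using key _ 0 (by simpa using hγ'.2.1)
      · simpa using key _ 0 (by simpa using hγ'.2.2.1)
      · simpa using key _ 1 (by simpa using hγ'.2.2.2)
    have hmemK : iota m (γ : SL(2, ℤ)) ∈ K := hKL _ hdvd
    rw [hK] at hmemK
    obtain ⟨d, hd, hdγ⟩ := Subgroup.mem_map.1 hmemK
    rw [MonoidHom.mem_ker] at hd
    rw [← hΦχ γ, ← hdγ]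
    exact hd
  exact map_eq_one_of_parabolic_of_congruence hL χ hpar hcong

/-- **NONEXTENSION (homomorphism form)**: the same with the extension given as a homomorphism `Φ : Δ →* F` on the
subgroup `Δ = Γ₀(M; ℤ[1/m])` (`ι γ ∈ Δ` by `iota_mem_delta`).
[cite: SerreSL2Congruence1970, §2.6 Thm. 2 (b), Cor. 3] [cite: KurthLong2008, Prop. 3.2] -/
theorem map_eq_one_of_parabolic_of_extends_hom (hm : 2 ≤ m) (hM : 0 < M) (hMN : M ∣ N)
    {F : Type*} [Group F] [Finite F] (χ : Gamma0 N →* F)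
    (hpar : ∀ γ : Gamma0 N, (γ : SL(2, ℤ)) = e12 1 ∨ (γ : SL(2, ℤ)) = e21 (N : ℤ) → χ γ = 1)
    (Φ : Delta m M →* F)
    (hΦχ : ∀ γ : Gamma0 N, Φ ⟨iota m (γ : SL(2, ℤ)), iota_mem_delta hMN γ⟩ = χ γ) :
    ∀ γ ∈ Gamma1' N, χ γ = 1 := by
  classical
  -- extend `Φ` by `1` off `Δ`
  let Φ' : SL(2, Away m) → F := fun g => if h : g ∈ Delta m M then Φ ⟨g, h⟩ else 1
  refine map_eq_one_of_parabolic_of_extends hm hM χ hpar Φ' ?_ ?_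
  · intro g hg g' hg'
    have hgg' : g * g' ∈ Delta m M := Subgroup.mul_mem _ hg hg'
    simp only [Φ', dif_pos hg, dif_pos hg', dif_pos hgg']
    rw [← map_mul]
    rfl
  · intro γ
    simp only [Φ', dif_pos (iota_mem_delta hMN γ)]
    exact hΦχ γ

/-- **NONEXTENSION for trace-`±2`-trivial («type II») characters** — the literal hypotheses of bsd-idea-17's
`FwSolenoid.NonExtension p M` at `N = pM` (there `Gamma0Away p M` = `Delta p M`, same carrier): a type-II homomorphism
`Γ₀(N) → F`, `F` finite, extending to `Γ₀(M; ℤ[1/m])`, kills `Γ₁(N)`.  Contrapositive: a CUSPIDAL character never extends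
(its cusp-label cocycle over the Hecke tree at `m` is not a coboundary).
[cite: SerreSL2Congruence1970, §2.6 Thm. 2 (b), Cor. 3] [cite: KurthLong2008, Prop. 3.2] -/
theorem map_eq_one_of_traceTwo_of_extends (hm : 2 ≤ m) (hM : 0 < M) (hMN : M ∣ N)
    {F : Type*} [Group F] [Finite F] (χ : Gamma0 N →* F)
    (htr : ∀ γ : Gamma0 N,
      ((γ : SL(2, ℤ)) 0 0 + (γ : SL(2, ℤ)) 1 1 = 2 ∨ (γ : SL(2, ℤ)) 0 0 + (γ : SL(2, ℤ)) 1 1 = -2) → χ γ = 1)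
    (Φ : Delta m M →* F)
    (hΦχ : ∀ γ : Gamma0 N, Φ ⟨iota m (γ : SL(2, ℤ)), iota_mem_delta hMN γ⟩ = χ γ) :
    ∀ γ ∈ Gamma1' N, χ γ = 1 := by
  refine map_eq_one_of_parabolic_of_extends_hom hm hM hMN χ (fun γ hγ => htr γ (Or.inl ?_)) Φ hΦχ
  rcases hγ with h | h <;> rw [h] <;> norm_num

/-- **The multiplicative-prime instance** (`N = pM`, `p` prime, `p ∤ M` not even needed): a type-II character of `Γ₀(pM)`
with finite image extending to `Γ₀(M; ℤ[1/p])` is Eisenstein — the algebraic half («NonExtension») of the ω⁰-mechanism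
`fw-solenoid` for `stub_muAnSurjDeepFive` / U5's rung, for EVERY prime `p` and level `M ≥ 1`.
[cite: SerreSL2Congruence1970, §2.6 Thm. 2 (b), Cor. 3] [cite: KurthLong2008, Prop. 3.2] -/
theorem nonExtension_mult {p M : ℕ} (hp : p.Prime) (hM : 0 < M)
    {F : Type*} [Group F] [Finite F] (χ : Gamma0 (p * M) →* F)
    (htr : ∀ γ : Gamma0 (p * M),
      ((γ : SL(2, ℤ)) 0 0 + (γ : SL(2, ℤ)) 1 1 = 2 ∨ (γ : SL(2, ℤ)) 0 0 + (γ : SL(2, ℤ)) 1 1 = -2) → χ γ = 1)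
    (Φ : Delta p M →* F)
    (hΦχ : ∀ γ : Gamma0 (p * M), Φ ⟨iota p (γ : SL(2, ℤ)), iota_mem_delta (Dvd.intro_left p rfl) γ⟩ = χ γ) :
    ∀ γ ∈ Gamma1' (p * M), χ γ = 1 :=
  map_eq_one_of_traceTwo_of_extends hp.two_le hM (Dvd.intro_left p rfl) χ htr Φ hΦχ

end NonExtension

end Summit.BirchSwinnertonDyer.BirchSwinnertonDyer.Theorems.Gamma0Parabolic
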